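import Mathlib.Analysis.Normed.Field.Basic
import Mathlib.Analysis.Normed.Ring.Lemmas
import Mathlib.Analysis.Normed.Group.Constructions
import Mathlib.Topology.Algebra.Ring.Basic
import Mathlib.Topology.MetricSpace.ProperSpace
import Mathlib.Topology.MetricSpace.Bounded
import Mathlib.LinearAlgebra.Matrix.Charpoly.Coeff
import HarnessLib

/-!
# The «quadratic × linear» factor datum of a cubic is PROPER over the coefficients
(compact support of the endoscopic class datum `(χ_g, u)` over a compact set of characteristic polynomials `χ_g · (X − u)`)

Topic `LinearAlgebra/Matrix`; namespace `Literature.LinearAlgebra.Matrix`.  THEOREMS ONLY (no definition, no instance, no notation, no named fact, no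
`sorry`); Mathlib-only imports.  Cell `pub/hodgecm-mathlib` (D-0151), crux H413 = stmt-HodgeConjecture-24833, F0∕P3a road «D-N6-ns», floor-2 line «N6nsGerm», stub
`stub_N6nsGlue` (SATURATION HALF, LEAD F0P3a-plan (g9) WORD T8-55 → B-p08 (g26); census `B-provers/B-p08/g26/sat/CENSUS-N6nsGlue-SATURATION.B-p08g26.md` file F1 = (σ-K)).
HONEST LABEL: HC_CM is proved only modulo the 2 remaining named inputs (hLiu418, h413) until rung 0 closes; this file proves no letter.

THE MATHEMATICS.  For the endoscopic pair `(H, G) = (U(2) × U(1), U(3))` the characteristic polynomial of `ι(γ_H)`, `γ_H = (g, u)`, is `χ_g · (X − u)` with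
`χ_g = X² + χ₁ X + χ₀` [Rogawski1990, §4.3 p. 42]; its lower coefficients are `(c₀, c₁, c₂) = (−χ₀u, χ₀ − χ₁u, χ₁ − u)`.  Over a finite product `R = Π_i 𝕜_i`
of PROPER normed fields (the local algebra `L ⊗ L⁺_v = Π_{w ∣ v} L_w`), the map `(χ₀, χ₁, u) ↦ (c₀, c₁, c₂)` has COMPACT preimages of compact sets: it is continuous, and on
the preimage of a ball of radius `M` one has, componentwise, `u_i³ + c₂,i u_i² + c₁,i u_i + c₀,i = 0` (a ring identity), whence the Cauchy bound `‖u_i‖ ≤ max 1 (3M)`, then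
`χ₁ = c₂ + u`, `χ₀ = c₁ + χ₁ u` are bounded; closed and bounded is compact in a proper space.  This is the «compactly supported modulo conjugation» input of
[LanglandsShelstad1990Descent, §2.2 Lemma 2.2.A p. 10] for the class datum `(χ_g, u)` of `H`, read off the compact support of a test function on `G`.

* §1 `cubic_root_identity` (the ring identity), `norm_le_max_one_of_cubic` (Cauchy bound in a normed field).
* §2 `isCompact_setOf_factorDatum_mem` (the properness, over `Π_i 𝕜_i`), `isCompact_of_isClosed_of_factorDatum_subset`.
* §3 the `Polynomial` reading: `coeff_mul_X_sub_C_of_monic_natDegree_two` and `charpoly_two_mul_X_sub_C_coeff` (for a `2 × 2` matrix `g` and a scalar `u`, the lower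
  coefficients of `g.charpoly * (X − C u)` ARE the factor datum map applied to `(χ₀, χ₁, u)`).

## References
* [Rogawski1990] J. D. Rogawski, *Automorphic Representations of Unitary Groups in Three Variables*, Ann. of Math. Stud. 123 (1990), §4.3 p. 42 (`ι : H → G`, `γ_H = (g, u)`), §3.1 p. 19.
* [LanglandsShelstad1990Descent] R. P. Langlands, D. Shelstad, *Descent for transfer factors*, Progr. Math. 87 (1990), §2.2 p. 10 («compactly supported modulo conjugation»).
-/

set_option autoImplicit false

open Set Metric Polynomial

namespace Literature.LinearAlgebra.Matrix

/-! ## §1 The cubic identity and the Cauchy bound -/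

section Identity

variable {R : Type*} [CommRing R]

/-- **`u` is a root of `(X² + χ₁X + χ₀)(X − u)`**, in coefficients: with `c₂ = χ₁ − u`, `c₁ = χ₀ − χ₁u`, `c₀ = −χ₀u` one has `u³ + c₂u² + c₁u + c₀ = 0` (a ring
identity). [cite: Rogawski1990, §4.3 p. 42] -/
theorem cubic_root_identity (χ₀ χ₁ u : R) :
    u ^ 3 + (χ₁ - u) * u ^ 2 + (χ₀ - χ₁ * u) * u + -(χ₀ * u) = 0 := by
  ring

end Identity

section Cauchy

variable {𝕜 : Type*} [NormedField 𝕜]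

/-- **Cauchy's root bound, cubic case**: if `u³ + c₂u² + c₁u + c₀ = 0` in a normed field and `‖c_k‖ ≤ M`, then `‖u‖ ≤ max 1 (3M)` (if `‖u‖ > 1` then
`‖u‖³ ≤ 3M‖u‖²`). [cite: Rogawski1990, §3.1 p. 19] -/
theorem norm_le_max_one_of_cubic {u c₀ c₁ c₂ : 𝕜} {M : ℝ} (h : u ^ 3 + c₂ * u ^ 2 + c₁ * u + c₀ = 0)
    (h₀ : ‖c₀‖ ≤ M) (h₁ : ‖c₁‖ ≤ M) (h₂ : ‖c₂‖ ≤ M) : ‖u‖ ≤ max 1 (3 * M) := by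
  by_cases hu : ‖u‖ ≤ 1
  · exact hu.trans (le_max_left _ _)
  · have hu' : 1 < ‖u‖ := not_le.1 hu
    refine le_trans ?_ (le_max_right _ _)
    have hM : 0 ≤ M := (norm_nonneg _).trans h₀
    have hu0 : 0 < ‖u‖ := zero_lt_one.trans hu'
    have hu1 : (1 : ℝ) ≤ ‖u‖ ^ 2 := by nlinarith
    have hu2 : ‖u‖ ≤ ‖u‖ ^ 2 := by nlinarith
    -- `u³ = -(c₂u² + c₁u + c₀)`
    have h3 : u ^ 3 = -(c₂ * u ^ 2 + c₁ * u + c₀) := by rw [eq_neg_iff_add_eq_zero, ← h]; ring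
    have e2 : ‖c₂‖ * ‖u‖ ^ 2 ≤ M * ‖u‖ ^ 2 := mul_le_mul_of_nonneg_right h₂ (by positivity)
    have e1 : ‖c₁‖ * ‖u‖ ≤ M * ‖u‖ ^ 2 :=
      (mul_le_mul_of_nonneg_right h₁ (norm_nonneg _)).trans (mul_le_mul_of_nonneg_left hu2 hM)
    have e0 : ‖c₀‖ ≤ M * ‖u‖ ^ 2 := h₀.trans (by nlinarith)
    have hbound : ‖u‖ ^ 3 ≤ 3 * M * ‖u‖ ^ 2 := by
      calc ‖u‖ ^ 3 = ‖u ^ 3‖ := (norm_pow u 3).symm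
        _ = ‖c₂ * u ^ 2 + c₁ * u + c₀‖ := by rw [h3, norm_neg]
        _ ≤ ‖c₂ * u ^ 2‖ + ‖c₁ * u‖ + ‖c₀‖ := norm_add₃_le
        _ = ‖c₂‖ * ‖u‖ ^ 2 + ‖c₁‖ * ‖u‖ + ‖c₀‖ := by rw [norm_mul, norm_mul, norm_pow]
        _ ≤ M * ‖u‖ ^ 2 + M * ‖u‖ ^ 2 + M * ‖u‖ ^ 2 := add_le_add (add_le_add e2 e1) e0
        _ = 3 * M * ‖u‖ ^ 2 := by ring
    -- divide by `‖u‖² > 0`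
    have hu2pos : 0 < ‖u‖ ^ 2 := by positivity
    have : ‖u‖ * ‖u‖ ^ 2 ≤ 3 * M * ‖u‖ ^ 2 := by rw [← pow_succ']; exact hbound
    exact le_of_mul_le_mul_right this hu2pos

end Cauchy

/-! ## §2 The factor datum map has compact fibres over compact sets (finite products of proper normed fields) -/

section Proper

variable {ι : Type*} [Fintype ι] {𝕜 : ι → Type*} [∀ i, NormedField (𝕜 i)] [∀ i, ProperSpace (𝕜 i)]

/-- **PROPERNESS OF THE FACTOR DATUM.**  `R = Π_i 𝕜_i` a finite product of proper normed fields; for every compact `Q ⊆ R × R × R` the set of data `(χ₀, χ₁, u) ∈ R × R × R`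
whose cubic coefficients `(−χ₀u, χ₀ − χ₁u, χ₁ − u)` lie in `Q` is COMPACT (continuity + the componentwise Cauchy bound §1 + `χ₁ = c₂ + u`, `χ₀ = c₁ + χ₁u`; closed and bounded
in a proper space). [cite: LanglandsShelstad1990Descent, §2.2 p. 10] [cite: Rogawski1990, §4.3 p. 42] -/
theorem isCompact_setOf_factorDatum_mem {Q : Set ((Π i, 𝕜 i) × (Π i, 𝕜 i) × (Π i, 𝕜 i))} (hQ : IsCompact Q) :
    IsCompact {x : (Π i, 𝕜 i) × (Π i, 𝕜 i) × (Π i, 𝕜 i) | (-(x.1 * x.2.2), x.1 - x.2.1 * x.2.2, x.2.1 - x.2.2) ∈ Q} := by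
  -- the map and its continuity
  have hF : Continuous fun x : (Π i, 𝕜 i) × (Π i, 𝕜 i) × (Π i, 𝕜 i) => (-(x.1 * x.2.2), x.1 - x.2.1 * x.2.2, x.2.1 - x.2.2) :=
    (continuous_fst.mul continuous_snd.snd).neg.prodMk
      ((continuous_fst.sub (continuous_snd.fst.mul continuous_snd.snd)).prodMk (continuous_snd.fst.sub continuous_snd.snd))
  refine Metric.isCompact_of_isClosed_isBounded (hQ.isClosed.preimage hF) ?_
  -- a bound `M` for `Q`
  obtain ⟨M, hM⟩ := (Metric.isBounded_iff_subset_closedBall 0).1 hQ.isBounded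
  set B : ℝ := max 1 (3 * M) with hB
  have hB0 : 0 ≤ B := zero_le_one.trans (le_max_left _ _)
  refine (Metric.isBounded_iff_subset_closedBall 0).2 ⟨max (M + (M + B) * B) (max (M + B) B), fun x hx => ?_⟩
  obtain ⟨χ₀, χ₁, u⟩ := x
  have hq : (-(χ₀ * u), χ₀ - χ₁ * u, χ₁ - u) ∈ closedBall (0 : (Π i, 𝕜 i) × (Π i, 𝕜 i) × (Π i, 𝕜 i)) M := hM hx
  rw [mem_closedBall, dist_zero_right] at hq
  have hc₀ : ‖-(χ₀ * u)‖ ≤ M := (norm_fst_le _).trans hq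
  have hc₁ : ‖χ₀ - χ₁ * u‖ ≤ M := ((norm_fst_le _).trans (norm_snd_le _)).trans hq
  have hc₂ : ‖χ₁ - u‖ ≤ M := ((norm_snd_le _).trans (norm_snd_le _)).trans hq
  have hMnn : 0 ≤ M := (norm_nonneg _).trans hc₀
  -- componentwise Cauchy bound for `u`
  have hu : ‖u‖ ≤ B := by
    refine (pi_norm_le_iff_of_nonneg hB0).2 fun i => ?_
    refine norm_le_max_one_of_cubic (c₀ := (-(χ₀ * u)) i) (c₁ := (χ₀ - χ₁ * u) i) (c₂ := (χ₁ - u) i) ?_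
      ((norm_le_pi_norm _ i).trans hc₀) ((norm_le_pi_norm _ i).trans hc₁) ((norm_le_pi_norm _ i).trans hc₂)
    simp only [Pi.neg_apply, Pi.mul_apply, Pi.sub_apply]
    exact cubic_root_identity (χ₀ i) (χ₁ i) (u i)
  -- then `χ₁ = (χ₁ - u) + u` and `χ₀ = (χ₀ - χ₁u) + χ₁u`
  have hχ₁ : ‖χ₁‖ ≤ M + B := by
    calc ‖χ₁‖ = ‖(χ₁ - u) + u‖ := by rw [sub_add_cancel]
      _ ≤ ‖χ₁ - u‖ + ‖u‖ := norm_add_le _ _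
      _ ≤ M + B := add_le_add hc₂ hu
  have hχ₀ : ‖χ₀‖ ≤ M + (M + B) * B := by
    calc ‖χ₀‖ = ‖(χ₀ - χ₁ * u) + χ₁ * u‖ := by rw [sub_add_cancel]
      _ ≤ ‖χ₀ - χ₁ * u‖ + ‖χ₁ * u‖ := norm_add_le _ _
      _ ≤ M + ‖χ₁‖ * ‖u‖ := add_le_add hc₁ (norm_mul_le χ₁ u)
      _ ≤ M + (M + B) * B := by gcongr
  rw [mem_closedBall, dist_zero_right]
  simp only [Prod.norm_def]
  exact max_le_max hχ₀ (max_le_max hχ₁ hu)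

/-- **Properness, `⊆` form**: a set of data whose cubic coefficients all lie in a compact `Q` and which is CLOSED is compact. [cite: LanglandsShelstad1990Descent, §2.2 p. 10] -/
theorem isCompact_of_isClosed_of_factorDatum_subset {S : Set ((Π i, 𝕜 i) × (Π i, 𝕜 i) × (Π i, 𝕜 i))} (hS : IsClosed S)
    {Q : Set ((Π i, 𝕜 i) × (Π i, 𝕜 i) × (Π i, 𝕜 i))} (hQ : IsCompact Q)
    (h : ∀ x ∈ S, (-(x.1 * x.2.2), x.1 - x.2.1 * x.2.2, x.2.1 - x.2.2) ∈ Q) : IsCompact S :=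
  (isCompact_setOf_factorDatum_mem hQ).of_isClosed_subset hS fun x hx => h x hx

end Proper

/-! ## §3 The `Polynomial` reading: lower coefficients of `χ · (X − C u)` for monic quadratic `χ`, and of `charpoly g · (X − C u)` for `2 × 2` `g` -/

section PolynomialReading

variable {R : Type*} [CommRing R]

/-- **Coefficients of `χ · (X − u)` for `χ = X² + χ₁X + χ₀` monic of degree `2`**: `coeff 0 = −χ₀u`, `coeff 1 = χ₀ − χ₁u`, `coeff 2 = χ₁ − u`
(Mathlib `coeff_mul_X_sub_C`, `mul_coeff_zero`). [cite: Rogawski1990, §4.3 p. 42] -/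
theorem coeff_mul_X_sub_C_of_monic_natDegree_two (χ : R[X]) (hχ : χ.Monic) (hdeg : χ.natDegree = 2) (u : R) :
    (χ * (X - C u)).coeff 0 = -(χ.coeff 0 * u) ∧ (χ * (X - C u)).coeff 1 = χ.coeff 0 - χ.coeff 1 * u ∧
      (χ * (X - C u)).coeff 2 = χ.coeff 1 - u := by
  have h2 : χ.coeff 2 = 1 := by rw [← hdeg]; exact hχ.coeff_natDegree
  refine ⟨?_, ?_, ?_⟩
  · rw [mul_coeff_zero, coeff_sub, coeff_X_zero, coeff_C_zero, zero_sub, mul_neg]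
  · exact coeff_mul_X_sub_C
  · rw [show (2 : ℕ) = 1 + 1 from rfl, coeff_mul_X_sub_C, h2, one_mul]

variable [Nontrivial R]

/-- **For a `2 × 2` matrix `g` and a scalar `u`**: the lower coefficients of `charpoly g · (X − C u)` (the characteristic polynomial of the block matrix `diag(g, u)`, i.e. of
`ι(γ_H)` for `γ_H = (g, u)`) are the factor-datum map applied to `(χ₀, χ₁, u)`, `χ_k = (charpoly g).coeff k`. [cite: Rogawski1990, §4.3 p. 42] -/
theorem charpoly_two_mul_X_sub_C_coeff (g : _root_.Matrix (Fin 2) (Fin 2) R) (u : R) :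
    (g.charpoly * (X - C u)).coeff 0 = -(g.charpoly.coeff 0 * u) ∧ (g.charpoly * (X - C u)).coeff 1 = g.charpoly.coeff 0 - g.charpoly.coeff 1 * u ∧
      (g.charpoly * (X - C u)).coeff 2 = g.charpoly.coeff 1 - u :=
  coeff_mul_X_sub_C_of_monic_natDegree_two g.charpoly g.charpoly_monic (by rw [Matrix.charpoly_natDegree_eq_dim, Fintype.card_fin]) u

end PolynomialReading

end Literature.LinearAlgebra.Matrix
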